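import Summits.QuantumFields.BalabanUV.T4Continuum.Support.NE7TangentCriticalCover
import Summits.QuantumFields.BalabanUV.T4Continuum.Support.NE3EnergyHessBilin
import Summits.QuantumFields.BalabanUV.T4Continuum.Support.NE3LiftDefectCorrection
import HarnessLib

/-!
# NE7SliceLetterCover — THE SLICE-SOLVER LETTER LIFTS DOWN FROM EVERY COVER OF THE TORUS: if the (c₁)-type letter (functional or source form,
# any period-free side condition on the field) holds for the background `W` read with period `L^{k+1}·(N·m)`, it holds with period `L^{k+1}·N`,
# SAME constants — so an analytic proof of (c₁) may assume as many blocks per side as it likes (file 79 of the curved (APE), F149: the small-volume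
# corner of every localisation argument, closed once and for all; functional form — source form in `NE7SliceLetterCoverSource`)

Cell `pub-balaban`, rung (B)+1 sub-cell t4, lineage `b2b-balaban-t4-ne7-p1` (CRUX PROVER NE7 #1 = OWNER of row NE7), generation 82; memo
`t4/b2b-balaban-t4-ne7-p1-g82/LOCALISATION-ROAD.md` §3.  Over lineage #2's `NE7TangentCriticalCover` (gen 89: deck sums, `dirIter_shiftDir`,
`dirIter_finset_sum`, `sum_perWin`, `sum_periodBox_mul_of_periodic`), `NE3EnergyHessBilin` (bilinearity of `hess`), `NE3LiftDefectCorrection.dirL1_add_le`,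
`NE3BlockLineAverage.sum_periodBox_blocks`, `NE7LatticeLandauMinimiser.sum_periodBox_shift_vec`.
WHY.  Every sup-norm proof of the remaining letter (c₁) of the curved (APE) END (F142∕F145∕F148: a bound on `‖curl_W X‖_∞` for `W`-tangent skew periodic
`X` from an `ℓ¹`-dual bound of the slice functional `Y ↦ hess W X Y`) that LOCALISES — cut-offs on a scale `K·M` about the point where the curl is
evaluated, a good local gauge there, the flat rows as the black box (memo §2) — needs room: `N ≥ N₀(K)` blocks per side.  The letter is stated for
every `N ≥ 1`.  THIS file removes the small-volume corner by the covering trick: a `P`-periodic background and field ARE `P·m`-periodic, the sup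
norms do not see the period, and the slice functional against a `P·m`-periodic tangent test `Y` over the big window equals the slice functional
against its DECK SUM `Ȳ = Σ_{s∈[0,m)^d} Y(· + P•s)` (a `P`-periodic tangent test) over the small window, while `‖Ȳ‖_{ℓ¹([0,P)^d)} ≤ ‖Y‖_{ℓ¹([0,Pm)^d)}`.
So the functional hypothesis at period `P` implies the functional hypothesis at period `P·m` with the same `g`, and the conclusion is identical.
WHAT ([folklore]; 0 def, 0 sorry; every `d`, `L ≥ 1`, every `n`).  §1 translation covariance of the Hessian density (`curlAt_shiftDir'`, `dcurlAt_shiftDir`,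
`hessPlaqAt_shiftDir`, `hessPlaqAt_add_period`); §2 the Hessian over period windows (`hess_perWin_eq`, `hess_shiftDir_right_perWin`, `hess_finset_sum_right`,
`hess_perWin_mul`); §3 the deck sum `deck P m Y := Σ_{s∈[0,m)^d} Y(· + P•s)` written inline (`isSkewDir_deck`, `isPeriodicDir_deck`, `dirIter_deck_eq_zero`,
**`hess_deck_eq`**: `hess W X Y (perWin (P·m)) = hess W X Ȳ (perWin P)`, **`dirL1_deck_le`**); §4 **`hessFunctional_cover`** (the `ℓ¹`-dual bound lifts to the
cover); §5 **`sliceLetter_cover`** — for ANY period-free side condition `C` and constants `(K_G, K_X)`: the two-term functional letter at period `L^{k+1}·(N·m)`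
implies the letter at period `L^{k+1}·N`; **`sliceLetter_of_large`** — it suffices to prove the letter for `N ≥ N₀`.  (The source form of F148: companion file
`NE7SliceLetterCoverSource`.)
HONEST FRAMING (page 1): elementary lattice bookkeeping BY NAME; no estimate; (c₁) NOT proved, asserted for no datum; nothing of Bałaban's asserted; (APE) on
curved data NOT proved; NOT ONE-STEP, NOT NE7; spine 0∕9; finite T⁴ rung (B)+1 — NOT infinite volume, NOT mass gap, NOT `BetaPertH`, NOT Clay.  Continuum YM on
T⁴ ⇐ BetaPertH ∧ nine spine estimates (0/9 proved); BetaPertH ⇐ (D1) ∧ (D4) ∧ CAP+tail; G-an2-4 gates asym, D1 and NE2/3/4.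
-/

set_option autoImplicit false

open scoped BigOperators Matrix.Norms.L2Operator
open Finset

namespace Summit.QuantumFields.BalabanUV.T4Continuum.NE7SliceLetterCover

open Literature.MathematicalPhysics.QuantumFieldTheory.Balaban1983to89
open B7Prop1Explicit B7Prop2Explicit UnitaryModel
open T4AveragingDeficitWall (IsUnitaryCfg IsSkewDir SmallField Ad curlAt dirL1 nReTrL nReTrL_apply)
open T4AveragingDeficitWallBoundary (IsPeriodicCfg periodBox mem_periodBox)
open AveragingDeficitPeriodicCounting (IsPeriodicDir)
open AveragingDeficitMultiLevelPrep (LevelSmall)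
open AveragingDeficitLiftPeriodic (shiftDir hol_shift)
open MinimalActionLevels (perWin)
open NE3HessForm (hess hessPlaq hessPlaqAt dcurlAt)
open NE3EnergyHessBilin (hessBilin hessBilin_apply)
open NE3TangentCovariantTower (dirIter)
open NE7TangentCriticalCover (invariant_smul_of_isPeriodicCfg dir_invariant_smul_of_isPeriodicDir isPeriodicCfg_mul isPeriodicDir_mul
  isSkewDir_shiftDir isPeriodicDir_shiftDir dirIter_shiftDir dirIter_finset_sum sum_perWin sum_periodBox_mul_of_periodic)
open NE7LatticeLandauMinimiser (sum_periodBox_shift_vec)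
open NE3BlockLineAverage (sum_periodBox_blocks)
open NE3LiftDefectCorrection (dirL1_add_le)
open PeriodicChoice (periodic_vec)

noncomputable section

variable {d : ℕ} {n : Type*} [Fintype n] [DecidableEq n]

/-! ## §1 Translation covariance of the Hessian density -/

/-- The dressed curl of the translated direction at the translated site (for `t`-invariant `U`), all index pairs. [folklore] -/
theorem curlAt_shiftDir' {U : Site d → Fin d → (Matrix n n ℂ)ˣ} {t : Site d} (hU : ∀ (x : Site d) (μ : Fin d), U (x + t) μ = U x μ)
    (φ : Site d → Fin d → Matrix n n ℂ) (z : Site d) (μ ν : Fin d) :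
    curlAt U (shiftDir t φ) (z + t) μ ν = curlAt U φ z μ ν := by
  simp only [curlAt, shiftDir, add_right_comm z t, hU, add_sub_cancel_right]

/-- The second-variation bracket density of `(U, X, Y(· − t))` at `z + t` is that of `(U, X, Y)` at `z`, for `t`-invariant `U`, `X`. [folklore] -/
theorem dcurlAt_shiftDir {U : Site d → Fin d → (Matrix n n ℂ)ˣ} {X : Site d → Fin d → Matrix n n ℂ} {t : Site d}
    (hU : ∀ (x : Site d) (μ : Fin d), U (x + t) μ = U x μ) (hX : ∀ (x : Site d) (μ : Fin d), X (x + t) μ = X x μ)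
    (φ : Site d → Fin d → Matrix n n ℂ) (z : Site d) (μ ν : Fin d) :
    dcurlAt U X (shiftDir t φ) (z + t) μ ν = dcurlAt U X φ z μ ν := by
  simp only [dcurlAt, shiftDir, add_right_comm z t, hU, hX, add_sub_cancel_right]

/-- **The mixed Hessian density is translation covariant**: `hessPlaqAt U X (Y(· − t)) (z + t) = hessPlaqAt U X Y z` for `t`-invariant `U`, `X`. [folklore] -/
theorem hessPlaqAt_shiftDir {U : Site d → Fin d → (Matrix n n ℂ)ˣ} {X : Site d → Fin d → Matrix n n ℂ} {t : Site d}
    (hU : ∀ (x : Site d) (μ : Fin d), U (x + t) μ = U x μ) (hX : ∀ (x : Site d) (μ : Fin d), X (x + t) μ = X x μ)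
    (φ : Site d → Fin d → Matrix n n ℂ) (z : Site d) (μ ν : Fin d) :
    hessPlaqAt U X (shiftDir t φ) (z + t) μ ν = hessPlaqAt U X φ z μ ν := by
  unfold hessPlaqAt
  rw [dcurlAt_shiftDir hU hX φ z μ ν, curlAt_shiftDir' hU φ z μ ν, hol_shift hU (plaqWord μ ν) z]
  have hXs : shiftDir t X = X := by
    funext y κ
    have h := hX (y - t) κ
    rw [sub_add_cancel] at h
    exact h.symm ▸ rfl
  have hc : curlAt U X (z + t) μ ν = curlAt U X z μ ν := by
    conv_lhs => rw [← hXs]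
    exact curlAt_shiftDir' hU X z μ ν
  rw [hc]

/-- The mixed Hessian density of `Q`-periodic data is `Q`-periodic in the base point. [folklore] -/
theorem hessPlaqAt_add_period {U : Site d → Fin d → (Matrix n n ℂ)ˣ} {X φ : Site d → Fin d → Matrix n n ℂ} {Q : ℤ}
    (hU : IsPeriodicCfg U Q) (hX : IsPeriodicDir X Q) (hφ : IsPeriodicDir φ Q) (z : Site d) (κ μ ν : Fin d) :
    hessPlaqAt U X φ (z + Q • e κ) μ ν = hessPlaqAt U X φ z μ ν := by
  have hφs : shiftDir (Q • e κ) φ = φ := by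
    funext y ι
    have h := hφ (y - Q • e κ) κ ι
    rw [sub_add_cancel] at h
    exact h.symm
  conv_lhs => rw [← hφs]
  exact hessPlaqAt_shiftDir (fun x ι => hU x κ ι) (fun x ι => hX x κ ι) φ z μ ν

/-! ## §2 The Hessian functional over period windows -/

/-- `hess` over the period window as a sum of a SITE DENSITY. [folklore] -/
theorem hess_perWin_eq (U : Site d → Fin d → (Matrix n n ℂ)ˣ) (X φ : Site d → Fin d → Matrix n n ℂ) (Q : ℕ) :
    hess U X φ (perWin d Q) = ∑ x ∈ periodBox (d := d) Q, ∑ π : T4AveragingDeficitWall.Plane d, hessPlaq U X φ (x, π) := by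
  unfold hess
  rw [sum_perWin]

/-- The Hessian site density of `Q`-periodic data is `Q`-periodic. [folklore] -/
theorem hessDensity_add_period {U : Site d → Fin d → (Matrix n n ℂ)ˣ} {X φ : Site d → Fin d → Matrix n n ℂ} {Q : ℤ}
    (hU : IsPeriodicCfg U Q) (hX : IsPeriodicDir X Q) (hφ : IsPeriodicDir φ Q) (x : Site d) (κ : Fin d) :
    (∑ π : T4AveragingDeficitWall.Plane d, hessPlaq U X φ (x + Q • e κ, π))
      = ∑ π : T4AveragingDeficitWall.Plane d, hessPlaq U X φ (x, π) := by
  refine Finset.sum_congr rfl fun π _ => ?_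
  exact hessPlaqAt_add_period hU hX hφ x κ π.1.1 π.1.2

/-- **THE SLICE FUNCTIONAL AGAINST A DECK TRANSLATE EQUALS THE SLICE FUNCTIONAL**: for `U`, `X`, `φ` of period `Q` and a translation `t` leaving
`U` and `X` invariant, `hess U X (φ(· − t)) (perWin Q) = hess U X φ (perWin Q)`. [folklore] -/
theorem hess_shiftDir_right_perWin {U : Site d → Fin d → (Matrix n n ℂ)ˣ} {X φ : Site d → Fin d → Matrix n n ℂ} {Q : ℕ} (hQ : 1 ≤ Q)
    (hUQ : IsPeriodicCfg U (Q : ℤ)) (hXQ : IsPeriodicDir X (Q : ℤ)) (hφQ : IsPeriodicDir φ (Q : ℤ)) {t : Site d}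
    (hUt : ∀ (x : Site d) (μ : Fin d), U (x + t) μ = U x μ) (hXt : ∀ (x : Site d) (μ : Fin d), X (x + t) μ = X x μ) :
    hess U X (shiftDir t φ) (perWin d Q) = hess U X φ (perWin d Q) := by
  rw [hess_perWin_eq, hess_perWin_eq]
  have hdens : ∀ x : Site d,
      (∑ π : T4AveragingDeficitWall.Plane d, hessPlaq U X (shiftDir t φ) (x, π))
        = ∑ π : T4AveragingDeficitWall.Plane d, hessPlaq U X φ (x + -t, π) := by
    intro x
    refine Finset.sum_congr rfl fun π _ => ?_
    have h1 := hessPlaqAt_shiftDir hUt hXt φ (x + -t) π.1.1 π.1.2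
    rw [neg_add_cancel_right] at h1
    exact h1
  simp_rw [hdens]
  exact sum_periodBox_shift_vec hQ (g := fun x => ∑ π : T4AveragingDeficitWall.Plane d, hessPlaq U X φ (x, π))
    (fun x κ => hessDensity_add_period hUQ hXQ hφQ x κ) (-t)

/-- `hess U X · W` is additive over finite sums of test directions. [folklore] -/
theorem hess_finset_sum_right (U : Site d → Fin d → (Matrix n n ℂ)ˣ) (X : Site d → Fin d → Matrix n n ℂ) {ι : Type*} (S : Finset ι)
    (F : ι → Site d → Fin d → Matrix n n ℂ) (W : Finset (T4AveragingDeficitWall.Plaq d)) :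
    hess U X (fun y μ => ∑ s ∈ S, F s y μ) W = ∑ s ∈ S, hess U X (F s) W := by
  have hF : (fun y μ => ∑ s ∈ S, F s y μ) = ∑ s ∈ S, F s := by
    funext y μ
    simp only [Finset.sum_apply]
  rw [hF, ← hessBilin_apply, map_sum]
  simp only [hessBilin_apply]

/-- The Hessian functional over the `m`-fold period window is `#[0,m)^d` times the functional over the period window, for `P`-periodic data.
[folklore] -/
theorem hess_perWin_mul {U : Site d → Fin d → (Matrix n n ℂ)ˣ} {X φ : Site d → Fin d → Matrix n n ℂ} {P : ℕ} (hP : 1 ≤ P) (m : ℕ)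
    (hUP : IsPeriodicCfg U (P : ℤ)) (hXP : IsPeriodicDir X (P : ℤ)) (hφP : IsPeriodicDir φ (P : ℤ)) :
    hess U X φ (perWin d (P * m)) = ((periodBox (d := d) m).card : ℝ) * hess U X φ (perWin d P) := by
  rw [hess_perWin_eq, hess_perWin_eq, sum_periodBox_mul_of_periodic hP m (fun x κ => hessDensity_add_period hUP hXP hφP x κ), nsmul_eq_mul]

/-! ## §3 The deck sum `Ȳ = Σ_{s∈[0,m)^d} Y(· + P•s)` of a test direction -/

omit [Fintype n] [DecidableEq n] in
/-- The deck sum of a skew direction is skew. [folklore] -/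
theorem isSkewDir_deck {φ : Site d → Fin d → Matrix n n ℂ} (hφ : IsSkewDir φ) (P : ℤ) (m : ℕ) :
    IsSkewDir (fun y μ => ∑ s ∈ periodBox (d := d) m, φ (y + P • s) μ) := by
  intro y μ
  exact sum_mem fun s _ => hφ _ μ

omit [Fintype n] [DecidableEq n] in
/-- **THE DECK SUM OF A `P·m`-PERIODIC DIRECTION IS `P`-PERIODIC** (the shift by `P e_κ` permutes the deck translates modulo `P·m`). [folklore] -/
theorem isPeriodicDir_deck {φ : Site d → Fin d → Matrix n n ℂ} {P : ℕ} {m : ℕ} (hm : 1 ≤ m)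
    (hφ : IsPeriodicDir φ (((P * m : ℕ) : ℤ))) :
    IsPeriodicDir (fun y μ => ∑ s ∈ periodBox (d := d) m, φ (y + (P : ℤ) • s) μ) (P : ℤ) := by
  intro y κ μ
  simp only
  have hg : ∀ (s : Site d) (κ' : Fin d), (fun s' : Site d => φ (y + (P : ℤ) • s') μ) (s + (m : ℤ) • e κ') =
      (fun s' : Site d => φ (y + (P : ℤ) • s') μ) s := by
    intro s κ'
    simp only
    have hper := hφ (y + (P : ℤ) • s) κ' μ
    rw [← hper]
    congr 1
    rw [smul_add, smul_smul]
    push_cast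
    abel
  have hshift := sum_periodBox_shift_vec hm (g := fun s' : Site d => φ (y + (P : ℤ) • s') μ) hg (e κ)
  rw [← hshift]
  refine Finset.sum_congr rfl fun s _ => ?_
  show φ (y + (P : ℤ) • e κ + (P : ℤ) • s) μ = φ (y + (P : ℤ) • (s + e κ)) μ
  congr 1
  rw [smul_add]
  abel

/-- The deck sum of a `W`-tangent direction is `W`-tangent (additivity and translation covariance of the linearised average through the tower, in the
multi-level small-field class), for `U` of period `L^{k+1}·N` and `P = L^{k+1}·N`. [folklore] -/
theorem dirIter_deck_eq_zero [Nonempty n] {L : ℕ} (hL : 1 ≤ L) (k : ℕ) {N : ℕ} (m : ℕ)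
    {U : Site d → Fin d → (Matrix n n ℂ)ˣ} (hU : IsUnitaryCfg U) {x : ℝ} (hx : 0 ≤ x) (hs : LevelSmall d L k x) (hUx : SmallField U x)
    (hUP : IsPeriodicCfg U ((L ^ (k + 1) * N : ℕ) : ℤ)) {φ : Site d → Fin d → Matrix n n ℂ} (hφT : dirIter L (k + 1) U φ = 0) :
    dirIter L (k + 1) U (fun y μ => ∑ s ∈ periodBox (d := d) m, φ (y + ((L ^ (k + 1) * N : ℕ) : ℤ) • s) μ) = 0 := by
  have hUinv : ∀ s : Site d, ∀ (y : Site d) (μ : Fin d), U (y + ((L : ℤ) ^ (k + 1)) • ((N : ℤ) • s)) μ = U y μ := by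
    intro s y μ
    have h := invariant_smul_of_isPeriodicCfg hUP s y μ
    rw [smul_smul]
    exact_mod_cast h
  have hre : (fun y μ => ∑ s ∈ periodBox (d := d) m, φ (y + ((L ^ (k + 1) * N : ℕ) : ℤ) • s) μ)
      = fun y μ => ∑ s ∈ periodBox (d := d) m, shiftDir (((L : ℤ) ^ (k + 1)) • ((N : ℤ) • (-s))) φ y μ := by
    funext y μ
    refine Finset.sum_congr rfl fun s _ => ?_
    simp only [shiftDir, smul_neg, sub_neg_eq_add, smul_smul]
    push_cast
    rfl
  rw [hre, dirIter_finset_sum hL k hU hx hs hUx]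
  funext z κ
  refine Finset.sum_eq_zero fun s _ => ?_
  rw [dirIter_shiftDir L (k + 1) (hUinv (-s)) φ, hφT]
  rfl

/-- **THE SLICE FUNCTIONAL OVER THE COVER WINDOW EQUALS THE SLICE FUNCTIONAL AGAINST THE DECK SUM OVER THE PERIOD WINDOW**: for `U`, `X` of period
`P ≥ 1` and a `P·m`-periodic test direction `φ` (`m ≥ 1`), `hess U X φ (perWin (P·m)) = hess U X Ȳ (perWin P)`, `Ȳ = Σ_{s∈[0,m)^d} φ(· + P•s)`. [folklore] -/
theorem hess_deck_eq {U : Site d → Fin d → (Matrix n n ℂ)ˣ} {X φ : Site d → Fin d → Matrix n n ℂ} {P m : ℕ} (hP : 1 ≤ P) (hm : 1 ≤ m)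
    (hUP : IsPeriodicCfg U (P : ℤ)) (hXP : IsPeriodicDir X (P : ℤ)) (hφ : IsPeriodicDir φ (((P * m : ℕ) : ℤ))) :
    hess U X φ (perWin d (P * m)) = hess U X (fun y μ => ∑ s ∈ periodBox (d := d) m, φ (y + (P : ℤ) • s) μ) (perWin d P) := by
  set φbar : Site d → Fin d → Matrix n n ℂ := fun y μ => ∑ s ∈ periodBox (d := d) m, φ (y + (P : ℤ) • s) μ with hφbar
  have hbP : IsPeriodicDir φbar (P : ℤ) := isPeriodicDir_deck hm hφ
  have hUPm : IsPeriodicCfg U (((P * m : ℕ) : ℤ)) := by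
    have h := isPeriodicCfg_mul hUP (m : ℤ)
    push_cast at h ⊢
    exact h
  have hXPm : IsPeriodicDir X (((P * m : ℕ) : ℤ)) := by
    have h := isPeriodicDir_mul hXP (m : ℤ)
    push_cast at h ⊢
    exact h
  have hPm1 : 1 ≤ P * m := Nat.one_le_iff_ne_zero.mpr (Nat.mul_ne_zero (by omega) (by omega))
  -- (a) the deck sum over the cover window: `#[0,m)^d` copies of the period window
  have ha : hess U X φbar (perWin d (P * m)) = ((periodBox (d := d) m).card : ℝ) * hess U X φbar (perWin d P) :=
    hess_perWin_mul hP m hUP hXP hbP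
  -- (b) the deck sum over the cover window: each translate has the same functional
  have hb : hess U X φbar (perWin d (P * m)) = ((periodBox (d := d) m).card : ℝ) * hess U X φ (perWin d (P * m)) := by
    have hre : φbar = fun y μ => ∑ s ∈ periodBox (d := d) m, shiftDir (-((P : ℤ) • s)) φ y μ := by
      funext y μ
      refine Finset.sum_congr rfl fun s _ => ?_
      simp only [shiftDir, sub_neg_eq_add]
    rw [hre, hess_finset_sum_right]
    have hterm : ∀ s ∈ periodBox (d := d) m, hess U X (shiftDir (-((P : ℤ) • s)) φ) (perWin d (P * m)) = hess U X φ (perWin d (P * m)) := by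
      intro s _
      refine hess_shiftDir_right_perWin hPm1 hUPm hXPm hφ ?_ ?_
      · intro y μ
        have h := invariant_smul_of_isPeriodicCfg hUP (-s) y μ
        rwa [smul_neg] at h
      · intro y μ
        have h := dir_invariant_smul_of_isPeriodicDir hXP (-s) y μ
        rwa [smul_neg] at h
    rw [Finset.sum_congr rfl hterm, Finset.sum_const, nsmul_eq_mul]
  have hcard : ((periodBox (d := d) m).card : ℝ) ≠ 0 := by
    have h0 : (0 : Site d) ∈ periodBox (d := d) m :=
      mem_periodBox.mpr fun κ => ⟨le_rfl, by show (0 : ℤ) < (m : ℤ); omega⟩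
    exact_mod_cast (Finset.card_pos.mpr ⟨0, h0⟩).ne'
  have := ha.symm.trans hb
  exact (mul_right_injective₀ hcard this).symm

/-- `‖·‖_{ℓ¹}` of a finite sum of directions is at most the sum of the `ℓ¹` norms. [folklore] -/
theorem dirL1_finset_sum_le {ι : Type*} (S : Finset ι) (F : ι → Site d → Fin d → Matrix n n ℂ) (B : Finset (Site d)) :
    dirL1 (fun y μ => ∑ s ∈ S, F s y μ) B ≤ ∑ s ∈ S, dirL1 (F s) B := by
  classical
  induction S using Finset.induction_on with
  | empty =>
      simp only [Finset.sum_empty]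
      unfold T4AveragingDeficitWall.dirL1
      simp
  | insert a S ha ih =>
      have hsplit : (fun y μ => ∑ s ∈ insert a S, F s y μ) = F a + fun y μ => ∑ s ∈ S, F s y μ := by
        funext y μ; rw [Finset.sum_insert ha]; rfl
      rw [hsplit, Finset.sum_insert ha]
      exact (dirL1_add_le _ _ B).trans (by linarith [ih])

/-- **THE `ℓ¹` NORM OF THE DECK SUM OVER THE PERIOD BOX IS AT MOST THE `ℓ¹` NORM OVER THE COVER BOX**:
`‖Ȳ‖_{ℓ¹([0,P)^d)} ≤ ‖Y‖_{ℓ¹([0,P·m)^d)}`. [folklore] -/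
theorem dirL1_deck_le {P : ℕ} (hP : 1 ≤ P) (m : ℕ) (φ : Site d → Fin d → Matrix n n ℂ) :
    dirL1 (fun y μ => ∑ s ∈ periodBox (d := d) m, φ (y + (P : ℤ) • s) μ) (periodBox (d := d) P)
      ≤ dirL1 φ (periodBox (d := d) (P * m)) := by
  refine (dirL1_finset_sum_le _ _ _).trans (le_of_eq ?_)
  unfold T4AveragingDeficitWall.dirL1
  rw [← sum_periodBox_blocks P m hP (fun w => ∑ κ : Fin d, ‖φ w κ‖)]
  refine Finset.sum_congr rfl fun s _ => Finset.sum_congr rfl fun v _ => ?_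
  simp only [add_comm v]

/-! ## §4 The functional hypothesis lifts to the cover -/

/-- **THE `ℓ¹`-DUAL BOUND OF THE SLICE FUNCTIONAL LIFTS TO EVERY COVER.**  For unitary `U` of period `P = L^{k+1}·N` in the multi-level small-field class and a
`P`-periodic `X`: if `|hess U X Y (perWin P)| ≤ g·‖Y‖_{ℓ¹([0,P)^d)}` for every skew `P`-periodic `U`-tangent `Y`, then for every `m ≥ 1` the same holds for every
skew `P·m`-periodic `U`-tangent `Y` over the cover window `perWin (P·m)` with `‖Y‖_{ℓ¹([0,P·m)^d)}` (`g ≥ 0`). [folklore] -/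
theorem hessFunctional_cover [Nonempty n] {L : ℕ} (hL : 1 ≤ L) (k : ℕ) {N : ℕ} (hN : 1 ≤ N) {m : ℕ} (hm : 1 ≤ m)
    {U : Site d → Fin d → (Matrix n n ℂ)ˣ} (hU : IsUnitaryCfg U) {x : ℝ} (hx : 0 ≤ x) (hs : LevelSmall d L k x) (hUx : SmallField U x)
    (hUP : IsPeriodicCfg U ((L ^ (k + 1) * N : ℕ) : ℤ))
    {X : Site d → Fin d → Matrix n n ℂ} (hXP : IsPeriodicDir X ((L ^ (k + 1) * N : ℕ) : ℤ)) {g : ℝ} (hg : 0 ≤ g)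
    (hXg : ∀ Y : Site d → Fin d → Matrix n n ℂ, IsSkewDir Y → IsPeriodicDir Y ((L ^ (k + 1) * N : ℕ) : ℤ) → dirIter L (k + 1) U Y = 0 →
      |hess U X Y (perWin d (L ^ (k + 1) * N))| ≤ g * dirL1 Y (periodBox (d := d) (L ^ (k + 1) * N))) :
    ∀ Y : Site d → Fin d → Matrix n n ℂ, IsSkewDir Y → IsPeriodicDir Y ((L ^ (k + 1) * (N * m) : ℕ) : ℤ) → dirIter L (k + 1) U Y = 0 →
      |hess U X Y (perWin d (L ^ (k + 1) * (N * m)))| ≤ g * dirL1 Y (periodBox (d := d) (L ^ (k + 1) * (N * m))) := by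
  intro Y hYs hYP hYT
  set P : ℕ := L ^ (k + 1) * N with hPdef
  have hPm : L ^ (k + 1) * (N * m) = P * m := by rw [hPdef, Nat.mul_assoc]
  rw [hPm] at hYP ⊢
  have hL0 : 0 < L := hL
  have hP1 : 1 ≤ P := Nat.one_le_iff_ne_zero.mpr (Nat.mul_ne_zero (pow_ne_zero _ hL0.ne') (by omega))
  set Ybar : Site d → Fin d → Matrix n n ℂ := fun y μ => ∑ s ∈ periodBox (d := d) m, Y (y + (P : ℤ) • s) μ with hYbar
  have hbs : IsSkewDir Ybar := isSkewDir_deck hYs (P : ℤ) m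
  have hbP : IsPeriodicDir Ybar (P : ℤ) := isPeriodicDir_deck hm hYP
  have hbT : dirIter L (k + 1) U Ybar = 0 := dirIter_deck_eq_zero hL k m hU hx hs hUx hUP hYT
  have h1 := hXg Ybar hbs hbP hbT
  rw [hess_deck_eq hP1 hm hUP hXP hYP]
  exact h1.trans (mul_le_mul_of_nonneg_left (dirL1_deck_le hP1 m Y) hg)

/-! ## §5 THE COVER TRANSFER OF THE SLICE-SOLVER LETTER -/

/-- **THE TWO-TERM SLICE-SOLVER LETTER LIFTS DOWN FROM THE `m`-FOLD COVER.**  Fix unitary `W` of period `L^{k+1}·N` in the multi-level small-field class,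
constants `(K_G, K_X)`, and ANY period-free side condition `C` on the field (e.g. «vanishes on the in-block comb bonds», F145; or `True`, F142's `S ⊇ tangent`).
If the letter «for every skew `C`-field `X` of period `Q`, `W`-tangent, with `‖X‖_∞ ≤ R` and `|hess W X Y (perWin Q)| ≤ g‖Y‖_{ℓ¹([0,Q)^d)}` on the skew `Q`-periodic
`W`-tangent tests, `‖curl_W X‖ ≤ K_G·g + K_X·R`» holds at `Q = L^{k+1}·(N·m)` for some `m ≥ 1`, then it holds at `Q = L^{k+1}·N`. [folklore] -/
theorem sliceLetter_cover [Nonempty n] {L : ℕ} (hL : 1 ≤ L) (k : ℕ) {N : ℕ} (hN : 1 ≤ N) {m : ℕ} (hm : 1 ≤ m)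
    {W : Site d → Fin d → (Matrix n n ℂ)ˣ} (hWu : IsUnitaryCfg W) {x : ℝ} (hx : 0 ≤ x) (hs : LevelSmall d L k x) (hWx : SmallField W x)
    (hWP : IsPeriodicCfg W ((L ^ (k + 1) * N : ℕ) : ℤ))
    (C : (Site d → Fin d → Matrix n n ℂ) → Prop) {KG KX : ℝ}
    (hbig : ∀ X : Site d → Fin d → Matrix n n ℂ, IsSkewDir X → C X →
      IsPeriodicDir X ((L ^ (k + 1) * (N * m) : ℕ) : ℤ) → dirIter L (k + 1) W X = 0 → ∀ R : ℝ, (∀ y κ', ‖X y κ'‖ ≤ R) → ∀ g : ℝ, 0 ≤ g →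
      (∀ Y : Site d → Fin d → Matrix n n ℂ, IsSkewDir Y → IsPeriodicDir Y ((L ^ (k + 1) * (N * m) : ℕ) : ℤ) → dirIter L (k + 1) W Y = 0 →
        |hess W X Y (perWin d (L ^ (k + 1) * (N * m)))| ≤ g * dirL1 Y (periodBox (d := d) (L ^ (k + 1) * (N * m)))) →
      ∀ z μ' ν', μ' ≠ ν' → ‖curlAt W X z μ' ν'‖ ≤ KG * g + KX * R) :
    ∀ X : Site d → Fin d → Matrix n n ℂ, IsSkewDir X → C X →
      IsPeriodicDir X ((L ^ (k + 1) * N : ℕ) : ℤ) → dirIter L (k + 1) W X = 0 → ∀ R : ℝ, (∀ y κ', ‖X y κ'‖ ≤ R) → ∀ g : ℝ, 0 ≤ g →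
      (∀ Y : Site d → Fin d → Matrix n n ℂ, IsSkewDir Y → IsPeriodicDir Y ((L ^ (k + 1) * N : ℕ) : ℤ) → dirIter L (k + 1) W Y = 0 →
        |hess W X Y (perWin d (L ^ (k + 1) * N))| ≤ g * dirL1 Y (periodBox (d := d) (L ^ (k + 1) * N))) →
      ∀ z μ' ν', μ' ≠ ν' → ‖curlAt W X z μ' ν'‖ ≤ KG * g + KX * R := by
  intro X hXs hXC hXP hXT R hXR g hg hXg z μ' ν' hne
  have hXPm : IsPeriodicDir X ((L ^ (k + 1) * (N * m) : ℕ) : ℤ) := by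
    have h := isPeriodicDir_mul hXP (m : ℤ)
    push_cast at h ⊢
    rw [mul_assoc] at h
    exact h
  exact hbig X hXs hXC hXPm hXT R hXR g hg (hessFunctional_cover hL k hN hm hWu hx hs hWx hWP hXP hg hXg) z μ' ν' hne

/-- **IT SUFFICES TO PROVE THE LETTER IN LARGE VOLUME.**  If the two-term slice-solver letter (side condition `C`, constants `(K_G, K_X)`) holds for the background
`W` read at every period `L^{k+1}·N′` with `N′ ≥ N₀` that `W` has, then it holds at `W`'s period `L^{k+1}·N` (`N ≥ 1`): read `W` at period
`L^{k+1}·(N·N₀)`. [folklore] -/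
theorem sliceLetter_of_large [Nonempty n] {L : ℕ} (hL : 1 ≤ L) (k : ℕ) {N : ℕ} (hN : 1 ≤ N) {N₀ : ℕ} (hN₀ : 1 ≤ N₀)
    {W : Site d → Fin d → (Matrix n n ℂ)ˣ} (hWu : IsUnitaryCfg W) {x : ℝ} (hx : 0 ≤ x) (hs : LevelSmall d L k x) (hWx : SmallField W x)
    (hWP : IsPeriodicCfg W ((L ^ (k + 1) * N : ℕ) : ℤ))
    (C : (Site d → Fin d → Matrix n n ℂ) → Prop) {KG KX : ℝ}
    (hbig : ∀ N' : ℕ, N₀ ≤ N' → IsPeriodicCfg W ((L ^ (k + 1) * N' : ℕ) : ℤ) →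
      ∀ X : Site d → Fin d → Matrix n n ℂ, IsSkewDir X → C X →
      IsPeriodicDir X ((L ^ (k + 1) * N' : ℕ) : ℤ) → dirIter L (k + 1) W X = 0 → ∀ R : ℝ, (∀ y κ', ‖X y κ'‖ ≤ R) → ∀ g : ℝ, 0 ≤ g →
      (∀ Y : Site d → Fin d → Matrix n n ℂ, IsSkewDir Y → IsPeriodicDir Y ((L ^ (k + 1) * N' : ℕ) : ℤ) → dirIter L (k + 1) W Y = 0 →
        |hess W X Y (perWin d (L ^ (k + 1) * N'))| ≤ g * dirL1 Y (periodBox (d := d) (L ^ (k + 1) * N'))) →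
      ∀ z μ' ν', μ' ≠ ν' → ‖curlAt W X z μ' ν'‖ ≤ KG * g + KX * R) :
    ∀ X : Site d → Fin d → Matrix n n ℂ, IsSkewDir X → C X →
      IsPeriodicDir X ((L ^ (k + 1) * N : ℕ) : ℤ) → dirIter L (k + 1) W X = 0 → ∀ R : ℝ, (∀ y κ', ‖X y κ'‖ ≤ R) → ∀ g : ℝ, 0 ≤ g →
      (∀ Y : Site d → Fin d → Matrix n n ℂ, IsSkewDir Y → IsPeriodicDir Y ((L ^ (k + 1) * N : ℕ) : ℤ) → dirIter L (k + 1) W Y = 0 →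
        |hess W X Y (perWin d (L ^ (k + 1) * N))| ≤ g * dirL1 Y (periodBox (d := d) (L ^ (k + 1) * N))) →
      ∀ z μ' ν', μ' ≠ ν' → ‖curlAt W X z μ' ν'‖ ≤ KG * g + KX * R := by
  have hWPm : IsPeriodicCfg W ((L ^ (k + 1) * (N * N₀) : ℕ) : ℤ) := by
    have h := isPeriodicCfg_mul hWP (N₀ : ℤ)
    push_cast at h ⊢
    rw [mul_assoc] at h
    exact h
  have hN' : N₀ ≤ N * N₀ := Nat.le_mul_of_pos_left N₀ (by omega)
  exact sliceLetter_cover hL k hN hN₀ hWu hx hs hWx hWP C (hbig (N * N₀) hN' hWPm)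

end

end Summit.QuantumFields.BalabanUV.T4Continuum.NE7SliceLetterCover
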